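import Summits.HodgeConjecture.HodgeConjecture.Theorems.H413E2SWDilateBoundCM
import Summits.HodgeConjecture.HodgeConjecture.Theorems.H413E2SWIdentityCloseFibre
import HarnessLib

/-!
# H413 · E-2 · SW2 (iii) — I-CLOSE: the fibrewise proportionality `hfib` at the CM ∕ unitary datum, from the letters (step (T4))

Cell `hodgecm-mathlib`, crux H413 (`stmt-HodgeConjecture-24833`), child line `Cruxes/H413/Lines/F0_E2SiegelWeilWeilRange.lean` ED. 8,
stub `stub_SW2iii_siegelWeil`, identity half; F0P4-plan (g4) SOCKET MAP 2026-08-31T04:38:08Z («BOUND plugs at `hbd`») and SOCKET #2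
04:53:12Z (null fibre).  KERNEL MATHEMATICS ONLY (no definition, no `sorry`); imports ★ (S-1) `Theorems.H413E2SWDilateBoundCM`
(F0P4-p05) and ★ (T3) `Theorems.H413E2SWIdentityCloseFibre`.  HC_CM is proved only modulo the 7 printed citations until rung 0 closes.

WHAT THIS FILE DOES.  It composes ★ (T3) `E2SWIdentityCloseFibre.integral_fibreMeasure_eq_smul_of_splitPlaceFrame` with ★ (S-1)
`E2SWDilateBoundCM.hbd_CM` (Weil's (39): the dilate bounds from (**)′ = `hBOUND`, the unipotent letter `hLN` and the Levi letter `hLD`)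
into the `hfib` binder of ★ (T1) `E2SWIdentityClose.doubledThetaIntegral_eq_mul_of_fibre` (= the `hFIB` binder of the final closer
`E2SWSiegelWeilCM.siegelWeil_weilRange_CM_of`, F0P4-p06), AT A GIVEN SPLIT-PLACE FRAME `(v, βv, fr, he1, he2)` and GIVEN the two
(T2a)-triples `H₁ H₂` for every `b` (A-p08 `E2SWIdentityCloseTriplesCM.exists_frame_identityClose_triples` for `b ≠ 0`; the null fibre
`b = 0` by (S-3θ)∕(S-3E)).  Remaining binders are exactly the letters of (S-1) (`Smat hhS 𝕋 h𝕋 j E'' hE'' hBOUND hLN hLD`) and `H₁ H₂`.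

References: A. Weil, *Sur la formule de Siegel dans la théorie des groupes classiques*, Acta Math. 113 (1965), Chap. V n° 50 (39)–(40)
p. 74; Chap. VI n° 52 Théorème 5 pp. 76–77 [Weil1965].
-/

set_option autoImplicit false
-- the cell's `Summit.HodgeConjecture.HodgeConjecture.…` namespace repeats the summit name by design (D-0017 layout)
set_option linter.dupNamespace false

noncomputable section

open MeasureTheory NumberField Filter Topology Set IsDedekindDomain
open scoped NNReal ENNReal Matrix ComplexConjugate
open Literature.NumberTheory.Automorphic Literature.NumberTheory.Automorphic.AdelicVector
open Literature.NumberTheory.Weil1964 Literature.NumberTheory.Weil1965 Literature.NumberTheory.Weil1965.UnitaryDoubling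
open Literature.NumberTheory.GaloisRepresentations.IsNonarchimedeanLocalField
open Literature.RepresentationTheory.HeisenbergGroup
open Summit.HodgeConjecture.HodgeConjecture.Cruxes.H413

namespace Summit.HodgeConjecture.HodgeConjecture.Cruxes.H413.E2SWIdentityCloseFibreCM

section Main

variable (F E : Type) [Field F] [NumberField F] [Field E] [NumberField E] [Algebra F E] [Algebra.IsQuadraticExtension F E]
  (c : E ≃ₐ[F] E) {δ : E} (hcδ : c δ = -δ) (hδ : δ ≠ 0) {d : F} (hd : δ * δ = algebraMap F E d)
  (N : ℕ) {n : ℕ} (e : Fin N × Fin 1 ≃ Fin n)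
  (TV : Matrix (Fin N) (Fin N) F) (hV : TV.IsSymm) (hVd : IsUnit TV.det)
  (TW : Matrix (Fin 1) (Fin 1) F) (hW : TW.IsSymm) (hWd : IsUnit TW.det)
  [LocallyCompactSpace (UnitaryGroup.adelic F E c N (TV.map (algebraMap F E)))]
  [CompactSpace (UnitaryGroup.adelic F E c N (TV.map (algebraMap F E)) ⧸ (UnitaryGroup.toAdelic F E c N (TV.map (algebraMap F E))).range)]
  [MeasurableSpace (UnitaryGroup.adelic F E c N (TV.map (algebraMap F E)) ⧸ (UnitaryGroup.toAdelic F E c N (TV.map (algebraMap F E))).range)]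
  [BorelSpace (UnitaryGroup.adelic F E c N (TV.map (algebraMap F E)) ⧸ (UnitaryGroup.toAdelic F E c N (TV.map (algebraMap F E))).range)]
  (ν : Measure (UnitaryGroup.adelic F E c N (TV.map (algebraMap F E)) ⧸ (UnitaryGroup.toAdelic F E c N (TV.map (algebraMap F E))).range))
  [IsFiniteMeasure ν]
  [MeasurableSpace (adeleQuotient F)] [BorelSpace (adeleQuotient F)]
  [MeasurableSpace (AdeleRing (𝓞 F) F)] [BorelSpace (AdeleRing (𝓞 F) F)]
  (νX : Measure (Fin (n + n) → AdeleRing (𝓞 F) F)) [νX.IsAddHaarMeasure]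
  (h : (Fin (n + n) → AdeleRing (𝓞 F) F) → AdeleRing (𝓞 F) F) (hh : Continuous h)

/-- **(T4) `hfib_CM_of` — THE `hfib` BINDER OF (T1) AT A GIVEN FRAME, FROM THE LETTERS.**  For every `b : F` and every NONNEGATIVE compactly
supported `Θ ∈ 𝒮_ℝ(X□(𝔸))`: `∫ Θ dμ̂_b = ν(univ) · ∫ Θ dμ_b` (theta-side fibre measure of `Λ_θ,ℝ` vs. Weil's `μ_b = E_X|_{h = b}`), from the
(T2a)-triples `H₁ H₂` of the frame (finite on compact rectangles, `GL`-invariant rectangle masses, carried by the split locus) and the letters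
of ★ (S-1) `hbd_CM` ((**)′ `hBOUND`, (L-N) `hLN`, (L-D-v) `hLD`).  Proof: ★ (T3) fed with ★ (S-1).
[cite: Weil1965, Chap. V n° 50, (39)–(40), p. 74] [cite: Weil1965, Chap. VI n° 52, Théorème 5, pp. 76–77] -/
theorem hfib_CM_of
    (hhN : ∀ x, h x = hNorm F E c hcδ hδ N e TV hVd TW hWd x)
    (hB : ∀ Φ ∈ piSchwartzBruhat F (Fin (n + n)), Summable fun ξ : F => ‖adelicSiegelCoeff F (Fin (n + n)) νX h Φ ξ‖)
    (Smat : Matrix (Fin (n + n)) (Fin (n + n)) (AdeleRing (𝓞 F) F))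
    (hhS : ∀ x, h x = Literature.NumberTheory.Weil1964.sdForm F Smat x)
    (𝕋 : Matrix (Fin (n + n)) (Fin (n + n)) (AdeleRing (𝓞 F) F)) (h𝕋 : IsUnit 𝕋.det)
    (j : ↥(UnitaryGroup.adelic F E c (1 + 1)
        ((Matrix.reindex finSumFinEquiv finSumFinEquiv (Matrix.fromBlocks TW 0 0 (-TW))).map (algebraMap F E))) →*
      ↥(symplecticGroup (polar (adelicForm F (Fin (n + n)) 𝕋))))
    (E'' : piSchwartzBruhat F (Fin (n + n)) →ₗ[ℂ] ℂ)
    (hE'' : ∀ Ψ : piSchwartzBruhat F (Fin (n + n)), E'' Ψ = thetaOrbitFunctional F E c hcδ hδ hd N e TV hV hVd TW hW hWd ν Ψ -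
      ((ν Set.univ).toReal : ℂ) * adelicSiegelFunctionalC F (Fin (n + n)) νX h hh hB Ψ)
    (hBOUND : ∀ Φ : piSchwartzBruhat F (Fin (n + n)), ∃ Mbound : ℝ,
      ∀ (p : adelicMpCont F (Fin (n + n)) 𝕋) (b : GL (Fin (1 + 1)) (AdeleRing (𝓞 E) E))
        (hb : b ∈ UnitaryGroup.adelic F E c (1 + 1)
        ((Matrix.reindex finSumFinEquiv finSumFinEquiv (Matrix.fromBlocks TW 0 0 (-TW))).map (algebraMap F E))),
        (b : Matrix (Fin (1 + 1)) (Fin (1 + 1)) (AdeleRing (𝓞 E) E)) 0 0 + (b : Matrix (Fin (1 + 1)) (Fin (1 + 1)) (AdeleRing (𝓞 E) E)) 0 1 =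
          (b : Matrix (Fin (1 + 1)) (Fin (1 + 1)) (AdeleRing (𝓞 E) E)) 1 0 + (b : Matrix (Fin (1 + 1)) (Fin (1 + 1)) (AdeleRing (𝓞 E) E)) 1 1 →
        adelicMpCont.proj F (Fin (n + n)) 𝕋 p = j ⟨b, hb⟩ →
        ‖E'' (adelicMpCont.omega F (Fin (n + n)) 𝕋 p Φ)‖ ≤ Mbound * Real.sqrt (adelicMpCont.l2Scaling F 𝕋 h𝕋 νX p).toReal)
    (hLN : ∀ β : AdeleRing (𝓞 F) F, ∃ (q : adelicMpCont F (Fin (n + n)) 𝕋) (u : GL (Fin (1 + 1)) (AdeleRing (𝓞 E) E))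
        (hu : u ∈ UnitaryGroup.adelic F E c (1 + 1)
        ((Matrix.reindex finSumFinEquiv finSumFinEquiv (Matrix.fromBlocks TW 0 0 (-TW))).map (algebraMap F E))),
        ((u : Matrix (Fin (1 + 1)) (Fin (1 + 1)) (AdeleRing (𝓞 E) E)) 0 0 + (u : Matrix (Fin (1 + 1)) (Fin (1 + 1)) (AdeleRing (𝓞 E) E)) 0 1 =
          (u : Matrix (Fin (1 + 1)) (Fin (1 + 1)) (AdeleRing (𝓞 E) E)) 1 0 + (u : Matrix (Fin (1 + 1)) (Fin (1 + 1)) (AdeleRing (𝓞 E) E)) 1 1) ∧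
        adelicMpCont.proj F (Fin (n + n)) 𝕋 q = j ⟨u, hu⟩ ∧ adelicMpCont.l2Scaling F 𝕋 h𝕋 νX q = 1 ∧
        ∀ Ψ : piSchwartzBruhat F (Fin (n + n)), adelicMpCont.omega F (Fin (n + n)) 𝕋 q Ψ = chirpLM F (β • Smat) Ψ)
    (v : HeightOneSpectrum (𝓞 F))
    {K : Type*} [Field K] [ValuativeRel K] [TopologicalSpace K] [IsNonarchimedeanLocalField K] [MeasurableSpace K] [BorelSpace K]
    [MeasurableSingletonClass K] (μK : Measure K) [μK.IsAddHaarMeasure]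
    {κ : Type*} [Fintype κ] [Nonempty κ] [DecidableEq κ] (hκ : 3 ≤ Fintype.card κ)
    (βv : (Fin (n + n) → v.adicCompletion F) ≃ₜ ((κ → K) × (κ → K)))
    (fr : (Fin (n + n) → AdeleRing (𝓞 F) F) ≃ₜ (((κ → K) × (κ → K)) × trivialAt F (Fin (n + n)) v))
    (he1 : ∀ x, (fr x).1 = βv (evalAt F (Fin (n + n)) v x))
    (he2 : ∀ x, (fr x).2 = ((placeSplitting F (Fin (n + n)) v).symm x).2)
    (hLD : ∀ s : K, s ≠ 0 → ∃ (q : adelicMpCont F (Fin (n + n)) 𝕋) (u : GL (Fin (1 + 1)) (AdeleRing (𝓞 E) E))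
        (hu : u ∈ UnitaryGroup.adelic F E c (1 + 1)
        ((Matrix.reindex finSumFinEquiv finSumFinEquiv (Matrix.fromBlocks TW 0 0 (-TW))).map (algebraMap F E))),
        ((u : Matrix (Fin (1 + 1)) (Fin (1 + 1)) (AdeleRing (𝓞 E) E)) 0 0 + (u : Matrix (Fin (1 + 1)) (Fin (1 + 1)) (AdeleRing (𝓞 E) E)) 0 1 =
          (u : Matrix (Fin (1 + 1)) (Fin (1 + 1)) (AdeleRing (𝓞 E) E)) 1 0 + (u : Matrix (Fin (1 + 1)) (Fin (1 + 1)) (AdeleRing (𝓞 E) E)) 1 1) ∧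
        adelicMpCont.proj F (Fin (n + n)) 𝕋 q = j ⟨u, hu⟩ ∧
        adelicMpCont.l2Scaling F 𝕋 h𝕋 νX q = ((normAbs K s : ℝ≥0) : ℝ≥0∞) ^ Fintype.card κ ∧
        ∀ (Ψ : piSchwartzBruhat F (Fin (n + n))) (x : Fin (n + n) → AdeleRing (𝓞 F) F),
          ((adelicMpCont.omega F (Fin (n + n)) 𝕋 q Ψ : piSchwartzBruhat F (Fin (n + n))) : (Fin (n + n) → AdeleRing (𝓞 F) F) → ℂ) x =
            (Ψ : (Fin (n + n) → AdeleRing (𝓞 F) F) → ℂ) (fr.symm (((s⁻¹ • (fr x).1.1, (fr x).1.2)), (fr x).2)))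
    (b' : F → K)
    (H₁ : ∀ b : F, (∀ (L : Set ((κ → K) × (κ → K))) (B : Set (trivialAt F (Fin (n + n)) v)), IsCompact L → IsCompact B →
        ((fibreMeasure F (Fin (n + n)) (thetaOrbitFunctionalReal F E c hcδ hδ hd N e TV hV hVd TW hW hWd ν) (thetaOrbitFunctionalReal_nonneg F E c hcδ hδ hd N e TV hV hVd TW hW hWd ν) h b).map fr) (L ×ˢ B) < ⊤) ∧
      (∀ (g : GL κ K) (A : Set ((κ → K) × (κ → K))) (B : Set (trivialAt F (Fin (n + n)) v)),
        MeasurableSet A → MeasurableSet B → ((fibreMeasure F (Fin (n + n)) (thetaOrbitFunctionalReal F E c hcδ hδ hd N e TV hV hVd TW hW hWd ν) (thetaOrbitFunctionalReal_nonneg F E c hcδ hδ hd N e TV hV hVd TW hW hWd ν) h b).map fr) (((fun z => (((g : Matrix κ κ K) *ᵥ z.1, ((g⁻¹ : GL κ K) : Matrix κ κ K)ᵀ *ᵥ z.2) : (κ → K) × (κ → K))) ⁻¹' A) ×ˢ B) = ((fibreMeasure F (Fin (n + n)) (thetaOrbitFunctionalReal F E c hcδ hδ hd N e TV hV hVd TW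 hW hWd ν) (thetaOrbitFunctionalReal_nonneg F E c hcδ hδ hd N e TV hV hVd TW hW hWd ν) h b).map fr) (A ×ˢ B)) ∧
      ((fibreMeasure F (Fin (n + n)) (thetaOrbitFunctionalReal F E c hcδ hδ hd N e TV hV hVd TW hW hWd ν) (thetaOrbitFunctionalReal_nonneg F E c hcδ hδ hd N e TV hV hVd TW hW hWd ν) h b).map fr) ({z : (κ → K) × (κ → K) | z.1 ⬝ᵥ z.2 = b' b ∧ z.1 ≠ 0 ∧ z.2 ≠ 0}ᶜ ×ˢ (univ : Set (trivialAt F (Fin (n + n)) v))) = 0)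
    (H₂ : ∀ b : F, (∀ (L : Set ((κ → K) × (κ → K))) (B : Set (trivialAt F (Fin (n + n)) v)), IsCompact L → IsCompact B →
        ((adelicSiegelFibreMeasure F (Fin (n + n)) νX h hh hB b).map fr) (L ×ˢ B) < ⊤) ∧
      (∀ (g : GL κ K) (A : Set ((κ → K) × (κ → K))) (B : Set (trivialAt F (Fin (n + n)) v)),
        MeasurableSet A → MeasurableSet B → ((adelicSiegelFibreMeasure F (Fin (n + n)) νX h hh hB b).map fr) (((fun z => (((g : Matrix κ κ K) *ᵥ z.1, ((g⁻¹ : GL κ K) : Matrix κ κ K)ᵀ *ᵥ z.2) : (κ → K) × (κ → K))) ⁻¹' A) ×ˢ B) = ((adelicSiegelFibreMeasure F (Fin (n + n)) νX h hh hB b).map fr) (A ×ˢ B)) ∧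
      ((adelicSiegelFibreMeasure F (Fin (n + n)) νX h hh hB b).map fr) ({z : (κ → K) × (κ → K) | z.1 ⬝ᵥ z.2 = b' b ∧ z.1 ≠ 0 ∧ z.2 ≠ 0}ᶜ ×ˢ (univ : Set (trivialAt F (Fin (n + n)) v))) = 0) :
    ∀ (b : F) (Θ : piSchwartzBruhatReal F (Fin (n + n))), 0 ≤ (Θ : (Fin (n + n) → AdeleRing (𝓞 F) F) → ℝ) →
      HasCompactSupport (Θ : (Fin (n + n) → AdeleRing (𝓞 F) F) → ℝ) →
      ∫ x, (Θ : (Fin (n + n) → AdeleRing (𝓞 F) F) → ℝ) x ∂(fibreMeasure F (Fin (n + n)) (thetaOrbitFunctionalReal F E c hcδ hδ hd N e TV hV hVd TW hW hWd ν) (thetaOrbitFunctionalReal_nonneg F E c hcδ hδ hd N e TV hV hVd TW hW hWd ν) h b) =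
        (ν Set.univ).toReal * ∫ x, (Θ : (Fin (n + n) → AdeleRing (𝓞 F) F) → ℝ) x ∂(adelicSiegelFibreMeasure F (Fin (n + n)) νX h hh hB b) := by
  intro b Θ h0 hc
  have hbd := E2SWDilateBoundCM.hbd_CM F E c hcδ hδ hd N e TV hV hVd TW hW hWd ν νX h hh hhN hB Smat hhS 𝕋 h𝕋 j E'' hE'' hBOUND hLN
    v hκ βv fr he1 he2 hLD b Θ h0 hc
  have hT3 := E2SWIdentityCloseFibre.integral_fibreMeasure_eq_smul_of_splitPlaceFrame F (Fin (n + n)) (thetaOrbitFunctionalReal F E c hcδ hδ hd N e TV hV hVd TW hW hWd ν)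
    (adelicSiegelFunctional F (Fin (n + n)) νX h hh hB) (thetaOrbitFunctionalReal_nonneg F E c hcδ hδ hd N e TV hV hVd TW hW hWd ν) (fun Ψ hΨ => (adelicSiegelFunctional_nonneg hh hB Ψ hΨ).1) h b v μK
    (le_trans (by norm_num) hκ) (b' b) (ν Set.univ).toNNReal βv fr he1 he2 (H₁ b)
    (by simpa only [adelicSiegelFibreMeasure] using H₂ b) Θ h0 hc
    (by simpa only [ENNReal.coe_toNNReal_eq_toReal, adelicSiegelFibreMeasure] using hbd)
  simpa only [ENNReal.coe_toNNReal_eq_toReal, adelicSiegelFibreMeasure] using hT3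

end Main

end Summit.HodgeConjecture.HodgeConjecture.Cruxes.H413.E2SWIdentityCloseFibreCM

end
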